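import Literature.AnabelianGeometry.EtaleTheta.FrobenioidThetaDivisorSupportQProp53
import Literature.AnabelianGeometry.EtaleTheta.FrobenioidThetaDivisorPrincipalTransport
import Literature.AnabelianGeometry.EtaleTheta.Discharge.Sec5Prop53ZeroPoleSplit
import HarnessLib

/-!
# [EtTh] §5, Prop. 5.3 over PERFECT `Φ(A_⊚)` with the F1 binders DISCHARGED, and «Prop. 5.3 (vi) read at the pair» SPLIT
# (`hsplit`) from the `Q` vocabulary (PROOF-ONLY; 0 definitions)

S. Mochizuki, *The étale theta function and its Frobenioid-theoretic manifestations*, Publ. RIMS **45** (2009)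
[MochizukiEtTh2009]: Prop. 5.3 p. 325–326 (PDF pp. 99–100), proof p. 326–327 (PDF pp. 100–101); Prop. 1.4 (i) p. 247
(PDF p. 21) («the zeroes of `Θ̈` … are precisely the cusps …; the divisor of poles … is … `D₁`»); Thm. 5.6 proof p. 329
(PDF p. 103) «since `Ψ` [essentially] preserves the divisor of zeroes and poles of `Θ̈` [cf. Proposition 5.3, (vi)] …»;
§4 p. 312 (PDF p. 86); S. Mochizuki, *The geometry of Frobenioids I* [MochizukiFrdI2008]: Rem. 1.1.1, Thm. 3.4 (ii)(v),
Thm. 4.9, Cor. 4.10.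
[cite: MochizukiEtTh2009, Prop 5.3 p.325–326 (PDF pp.99–100)] [cite: MochizukiEtTh2009, Thm 5.6 proof p.329 (PDF p.103)]
[cite: MochizukiFrdI2008, Thm. 4.9 p.88]

Cell abc-iut, layer L2 ([EtTh] §5), seat abc-iut-L6-d1 (gen 5), row «F1-BIRAT» (abc-iut-L2-lead R453 GO 2026-08-26T14:33Z).
Everything BY NAME: this lineage's perfect-`Φ` capstone `DivisorSupportDataQ.geometryOfDivisorsPreserved_of_principalQ`
(p447501) and `Q` transport kit (`ord_gpMap`, `eq_of_ord_eq`, `ord_mul`), the printed F1 `principalDivisors` with its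
transport theorems (`gpMap_psiPhi_mem_principalDivisors_iff`, `gpMap_pullAut_mem_principalDivisors_iff`;
`FrobenioidThetaDivisorPrincipal(Transport).lean`), abc-iut-w6-d043's LINK (c) split in order-coordinate form
(`DivisorPrimeData.psiPhi_eq_pullAut_split_of_orders`, p445571/p445732).

WHAT IS PROVED.
§1 («HSPLIT-FROM-Q», GAP-LEDGER G-w5d245-2 LINK (c) in the support vocabulary of record at perfect `Φ`): for
  `𝔖 : DivisorSupportDataQ 𝔓` under the integral binder `hInt`, Prop. 5.3 (i) on primes (`hc`), F1-Ψ, cusp-Aut, F1-Aut: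
  * `ord_gpMap_coe` — the `Q` orders are transported by `Ψ^Φ_{A_⊚}` / by `g ∈ Aut_C(A_⊚)` (the order-coordinate binders
    `hψo`/`hgo` of the split as THEOREMS);
  * `exists_pullAut_split_of_thetaOrbit` — Prop. 5.3 (vi) (`PreservesThetaDivisorOrbit`) + ANY zero/pole decomposition
    `div(Θ̈) = Z₀·W₀⁻¹` (`Z₀` of order `0` off the cusps, `W₀` of order `0` at the cusps; Prop. 1.4 (i)) ⊢ abc-iut-w5-d245's
    assembly binder VERBATIM: `∃ g, (Ψ^Φ)^gp Z₀ = g·Z₀ ∧ (Ψ^Φ)^gp W₀ = g·W₀` (`Sec5DivTransportAssembly.lean`, `hsplit`);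
  * `exists_pullAut_split_of_principalQ` — the same from the capstone's binders alone ((vi) supplied by
    `preservesThetaDivisorOrbit_of_principalQ`): {hInt, (i) on primes, F1-Ψ, profile `hdiv`, cusp-Aut, F1-Aut}.
§2 (F1 := `principalDivisors 𝔉.pre A_⊚`, the printed «image of the birational function monoid»): for `𝔖` whose F1 field IS
  that subgroup (`h𝔖`), the binders F1-Ψ / F1-Aut are REPLACED by their [FrdI] sources —
  * `geometryOfDivisorsPreserved_of_principalDivisors` — Prop. 5.3 (i)–(vi) (`GeometryOfDivisorsPreserved (ofThm49 𝔉) …`)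
    MODULO {`induced` ([FrdI] Thm. 4.9 divisor clause), (i) as typed, `Ψ^{±1}` preserve pre-steps and base-equivalent pairs
    ([FrdI] Thm. 3.4 (ii)(v)), `hiso` (isomorphisms are isometries), cusp-Aut, hInt, hdiv};
  * `exists_pullAut_split_of_principalDivisors` — `hsplit` modulo the same list.
HONEST FRAMING: implications between predicates on OUR typed §5 data; no `𝔖` with `principal = principalDivisors …` is
constructed here (owner: the genuine special fibre of `Ÿ`); non-vacuity of the `Q` vocabulary itself is p445530/p447613;
typed ≠ proved for the genuine curve; nothing here lies inside the [IUTchIII] Cor. 3.12 cone; no side taken.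
-/

namespace Literature.AnabelianGeometry.EtaleTheta

open CategoryTheory
open Literature.AlgebraicGeometry.Frobenioids

universe w v v' u u'

namespace FrobenioidThetaDivisors

open scoped Classical

variable {C : Type u} [Category.{v} C] {D : Type u'} [Category.{v'} D] {𝔉 : ThetaFrobenioid.{w} C D}
variable {𝔓 : DivisorPrimeData 𝔉}

namespace DivisorSupportDataQ

/-! ### §1 «HSPLIT-FROM-Q»: the assembly binder `hsplit` from Prop. 5.3 (vi)+(i) over `Q` -/

/-- The `Q` orders are transported by any monoid automorphism `ψ` preserving the principal elements, under the integral
binder — `ord_𝔮(ψ^gp x) = ord_{ψ⁻¹𝔮}(x)` (this lineage's `ord_gpMap`, in the coercion shape of the order-coordinate binders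
of abc-iut-w6-d043's split). [cite: MochizukiEtTh2009, Prop 5.3 proof p.326–327 (PDF pp.100–101)] -/
theorem ord_gpMap_coe (𝔖 : DivisorSupportDataQ 𝔓) (hI : 𝔖.PrincipalIffIntegralDegreeZero)
    (ψ : 𝔉.PhiAcirc ≃* 𝔉.PhiAcirc)
    (hP : ∀ x, ThetaFrobenioid.gpMap ψ.toMonoidHom x ∈ 𝔖.principal ↔ x ∈ 𝔖.principal)
    (𝔮 : Primes 𝔉.PhiAcirc) (x : Algebra.GrothendieckGroup 𝔉.PhiAcirc) :
    𝔖.ord 𝔮 (ThetaFrobenioid.gpMap (ψ : 𝔉.PhiAcirc →* 𝔉.PhiAcirc) x) = 𝔖.ord (Primes.congr ψ.symm 𝔮) x := by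
  rw [← MulEquiv.toMonoidHom_eq_coe]
  exact 𝔖.ord_gpMap ψ hI hP 𝔮 x

/-- `1 ∈ Aut_C(A_⊚)` acts trivially on `Φ(A_⊚)^gp`. [cite: MochizukiEtTh2009, Prop 5.3 (vi) p.326 (PDF p.100)] -/
theorem gpMap_pullAut_one (x : Algebra.GrothendieckGroup 𝔉.PhiAcirc) :
    ThetaFrobenioid.gpMap (𝔉.pullAut (1 : Aut 𝔉.Acirc) : 𝔉.PhiAcirc →* 𝔉.PhiAcirc) x = x := by
  have h1 : (𝔉.pullAut (1 : Aut 𝔉.Acirc) : 𝔉.PhiAcirc →* 𝔉.PhiAcirc) = MonoidHom.id _ := by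
    refine MonoidHom.ext fun y => ?_
    change 𝔉.pre.pull (𝔉.base.map (𝟙 𝔉.Acirc)) y = y
    rw [CategoryTheory.Functor.map_id, 𝔉.pre.pull_id]
  rw [h1, ThetaFrobenioid.gpMap, show Algebra.GrothendieckGroup.of.comp (MonoidHom.id 𝔉.PhiAcirc) =
    Algebra.GrothendieckGroup.of from MonoidHom.ext fun _ => rfl]
  have h2 : Algebra.GrothendieckGroup.lift (Algebra.GrothendieckGroup.of (M := 𝔉.PhiAcirc)) = MonoidHom.id _ :=
    Algebra.GrothendieckGroup.lift.symm.injective (by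
      rw [Equiv.symm_apply_apply, Algebra.GrothendieckGroup.lift_symm_apply, MonoidHom.id_comp])
  rw [h2, MonoidHom.id_apply]

section Split

variable (Ψ : C ≌ C) (ι : Ψ.functor.obj 𝔉.Acirc ≅ 𝔉.Acirc)
  (e : 𝔉.PhiAcirc ≃* 𝔉.pre.Mon (𝔉.base.obj (Ψ.functor.obj 𝔉.Acirc)))

/-- **«HSPLIT-FROM-Q» — abc-iut-w5-d245's assembly binder `hsplit` from Prop. 5.3 (vi)+(i) over the perfect-`Φ` support
vocabulary.**  Given `hInt`, (i) on primes, F1-Ψ, cusp-Aut, F1-Aut, the typed Prop. 5.3 (vi) (`PreservesThetaDivisorOrbit`)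
and ANY decomposition `div(Θ̈) = Z₀·W₀⁻¹` with `Z₀` of order `0` at every non-cuspidal prime and `W₀` of order `0` at every
cuspidal prime (zero part / pole part, Prop. 1.4 (i)): there is `g ∈ Aut_C(A_⊚)` with `(Ψ^Φ_{A_⊚})^gp Z₀ = g·Z₀` AND
`(Ψ^Φ_{A_⊚})^gp W₀ = g·W₀` — since `(Ψ^Φ)^gp div(Θ̈)` lies in the orbit, `= g·div(Θ̈)`, and the equality splits
(abc-iut-w6-d043's `psiPhi_eq_pullAut_split_of_orders`, whose separation / additivity / transport binders are the `Q`
theorems `eq_of_ord_eq` / `ord_mul` / `ord_gpMap`).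
[cite: MochizukiEtTh2009, Prop 5.3 (vi) p.326 (PDF p.100)] [cite: MochizukiEtTh2009, Thm 5.6 proof p.329 (PDF p.103)] -/
theorem exists_pullAut_split_of_thetaOrbit (𝔖 : DivisorSupportDataQ 𝔓) (hI : 𝔖.PrincipalIffIntegralDegreeZero)
    (hc : CuspPreserved 𝔓 Ψ ι e)
    (hP : ∀ x, ThetaFrobenioid.gpMap (psiPhi 𝔉 Ψ ι e).toMonoidHom x ∈ 𝔖.principal ↔ x ∈ 𝔖.principal)
    (hAc : ∀ (g : Aut 𝔉.Acirc) (𝔭 : Primes 𝔉.PhiAcirc),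
      𝔓.IsCuspidal (Primes.congr (𝔉.pullAut g) 𝔭) ↔ 𝔓.IsCuspidal 𝔭)
    (hAP : ∀ (g : Aut 𝔉.Acirc) (x : Algebra.GrothendieckGroup 𝔉.PhiAcirc),
      ThetaFrobenioid.gpMap (𝔉.pullAut g).toMonoidHom x ∈ 𝔖.principal ↔ x ∈ 𝔖.principal)
    (hvi : PreservesThetaDivisorOrbit 𝔓 Ψ ι e)
    {Z₀ W₀ : Algebra.GrothendieckGroup 𝔉.PhiAcirc} (hZW : 𝔓.divTheta = Z₀ * W₀⁻¹)
    (hZ : ∀ 𝔫, ¬ 𝔓.IsCuspidal 𝔫 → 𝔖.ord 𝔫 Z₀ = 0) (hW : ∀ 𝔠, 𝔓.IsCuspidal 𝔠 → 𝔖.ord 𝔠 W₀ = 0) :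
    ∃ g : Aut 𝔉.Acirc,
      ThetaFrobenioid.gpMap (psiPhi 𝔉 Ψ ι e : 𝔉.PhiAcirc →* 𝔉.PhiAcirc) Z₀ =
        ThetaFrobenioid.gpMap (𝔉.pullAut g : 𝔉.PhiAcirc →* 𝔉.PhiAcirc) Z₀ ∧
      ThetaFrobenioid.gpMap (psiPhi 𝔉 Ψ ι e : 𝔉.PhiAcirc →* 𝔉.PhiAcirc) W₀ =
        ThetaFrobenioid.gpMap (𝔉.pullAut g : 𝔉.PhiAcirc →* 𝔉.PhiAcirc) W₀ := by
  -- `div(Θ̈)` lies in its own orbit (`g = 1`), hence `(Ψ^Φ)^gp div(Θ̈)` lies in the orbit by (vi)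
  have h1 : 𝔓.divTheta ∈ Set.range fun g : Aut 𝔉.Acirc =>
      ThetaFrobenioid.gpMap (𝔉.pullAut g : 𝔉.PhiAcirc →* 𝔉.PhiAcirc) 𝔓.divTheta :=
    ⟨1, gpMap_pullAut_one 𝔓.divTheta⟩
  have h2 : ThetaFrobenioid.gpMap (psiPhi 𝔉 Ψ ι e : 𝔉.PhiAcirc →* 𝔉.PhiAcirc) 𝔓.divTheta ∈
      Set.range fun g : Aut 𝔉.Acirc => ThetaFrobenioid.gpMap (𝔉.pullAut g : 𝔉.PhiAcirc →* 𝔉.PhiAcirc) 𝔓.divTheta := by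
    rw [← hvi]
    exact ⟨_, h1, rfl⟩
  obtain ⟨g, hg⟩ := h2
  refine ⟨g, 𝔓.psiPhi_eq_pullAut_split_of_orders 𝔖.ord (fun x y h => 𝔖.eq_of_ord_eq h) 𝔖.ord_mul Ψ ι e hc
    (𝔖.ord_gpMap_coe hI (psiPhi 𝔉 Ψ ι e) hP) g (𝔖.ord_gpMap_coe hI (𝔉.pullAut g) (hAP g)) (hAc g) hZ hW ?_⟩
  rw [← hZW]
  exact hg.symm

/-- **`hsplit` from the capstone's binders alone**: as `exists_pullAut_split_of_thetaOrbit`, with Prop. 5.3 (vi) supplied by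
this lineage's `preservesThetaDivisorOrbit_of_principalQ` — i.e. from {hInt, (i) on primes, F1-Ψ, the symmetric profile
`hdiv` of `div(Θ̈)` on the components (Prop. 1.4 (i)), cusp-Aut, F1-Aut} and the zero/pole decomposition.
[cite: MochizukiEtTh2009, Prop 5.3 (vi) p.326 (PDF p.100)] [cite: MochizukiEtTh2009, Prop 1.4 (i) p.247 (PDF p.21)] -/
theorem exists_pullAut_split_of_principalQ (𝔖 : DivisorSupportDataQ 𝔓) (hI : 𝔖.PrincipalIffIntegralDegreeZero)
    (hc : CuspPreserved 𝔓 Ψ ι e)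
    (hP : ∀ x, ThetaFrobenioid.gpMap (psiPhi 𝔉 Ψ ι e).toMonoidHom x ∈ 𝔖.principal ↔ x ∈ 𝔖.principal)
    (θ : ℤ → ℚ) (s : ℤ) (hθ : ∀ j, θ (s - j) = θ j)
    (hdiv : ∀ (𝔫 : Primes 𝔉.PhiAcirc) (h𝔫 : ¬ 𝔓.IsCuspidal 𝔫),
      𝔖.ord 𝔫 𝔓.divTheta = θ (𝔓.ncspEquivZ ⟨𝔫, h𝔫⟩))
    (hAc : ∀ (g : Aut 𝔉.Acirc) (𝔭 : Primes 𝔉.PhiAcirc),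
      𝔓.IsCuspidal (Primes.congr (𝔉.pullAut g) 𝔭) ↔ 𝔓.IsCuspidal 𝔭)
    (hAP : ∀ (g : Aut 𝔉.Acirc) (x : Algebra.GrothendieckGroup 𝔉.PhiAcirc),
      ThetaFrobenioid.gpMap (𝔉.pullAut g).toMonoidHom x ∈ 𝔖.principal ↔ x ∈ 𝔖.principal)
    {Z₀ W₀ : Algebra.GrothendieckGroup 𝔉.PhiAcirc} (hZW : 𝔓.divTheta = Z₀ * W₀⁻¹)
    (hZ : ∀ 𝔫, ¬ 𝔓.IsCuspidal 𝔫 → 𝔖.ord 𝔫 Z₀ = 0) (hW : ∀ 𝔠, 𝔓.IsCuspidal 𝔠 → 𝔖.ord 𝔠 W₀ = 0) :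
    ∃ g : Aut 𝔉.Acirc,
      ThetaFrobenioid.gpMap (psiPhi 𝔉 Ψ ι e : 𝔉.PhiAcirc →* 𝔉.PhiAcirc) Z₀ =
        ThetaFrobenioid.gpMap (𝔉.pullAut g : 𝔉.PhiAcirc →* 𝔉.PhiAcirc) Z₀ ∧
      ThetaFrobenioid.gpMap (psiPhi 𝔉 Ψ ι e : 𝔉.PhiAcirc →* 𝔉.PhiAcirc) W₀ =
        ThetaFrobenioid.gpMap (𝔉.pullAut g : 𝔉.PhiAcirc →* 𝔉.PhiAcirc) W₀ :=
  𝔖.exists_pullAut_split_of_thetaOrbit Ψ ι e hI hc hP hAc hAP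
    (𝔖.preservesThetaDivisorOrbit_of_principalQ Ψ ι e hI hc hP θ s hθ hdiv hAc hAP) hZW hZ hW

end Split

/-! ### §2 F1 := `principalDivisors 𝔉.pre A_⊚`: the F1 binders replaced by their [FrdI] sources -/

section Principal

variable (Ψ : C ≌ C) (ι : Ψ.functor.obj 𝔉.Acirc ≅ 𝔉.Acirc)
  {e : 𝔉.PhiAcirc ≃* 𝔉.pre.Mon (𝔉.base.obj (Ψ.functor.obj 𝔉.Acirc))}

/-- **F1-Ψ (`hP`) for a support datum whose F1 field is the printed `principalDivisors`** — from `induced` ([FrdI] Thm. 4.9),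
[FrdI] Thm. 3.4 (ii)(v) for `Ψ^{±1}` and `hiso`. [cite: MochizukiEtTh2009, Prop 5.3 proof p.326 (PDF p.100)] [cite: MochizukiFrdI2008, Thm. 4.9 p.88] -/
theorem hP_of_principalDivisors (𝔖 : DivisorSupportDataQ 𝔓) (h𝔖 : 𝔖.principal = principalDivisors 𝔉.pre 𝔉.Acirc)
    (induced : (DivisorTransportStub.ofThm49 𝔉).IsInducedBy Ψ 𝔉.Acirc e)
    (hpre : ∀ ⦃X Y : C⦄ (φ : X ⟶ Y), 𝔉.pre.IsPreStep φ → 𝔉.pre.IsPreStep (Ψ.functor.map φ))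
    (hbe : ∀ ⦃X Y : C⦄ (φ ψ : X ⟶ Y), 𝔉.pre.BaseEquivalent φ ψ →
      𝔉.pre.BaseEquivalent (Ψ.functor.map φ) (Ψ.functor.map ψ))
    (hpre' : ∀ ⦃X Y : C⦄ (φ : X ⟶ Y), 𝔉.pre.IsPreStep φ → 𝔉.pre.IsPreStep (Ψ.inverse.map φ))
    (hbe' : ∀ ⦃X Y : C⦄ (φ ψ : X ⟶ Y), 𝔉.pre.BaseEquivalent φ ψ →
      𝔉.pre.BaseEquivalent (Ψ.inverse.map φ) (Ψ.inverse.map ψ))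
    (hiso : ∀ ⦃X Y : C⦄ (c : X ≅ Y), 𝔉.pre.div c.hom = 1)
    (x : Algebra.GrothendieckGroup 𝔉.PhiAcirc) :
    ThetaFrobenioid.gpMap (psiPhi 𝔉 Ψ ι e).toMonoidHom x ∈ 𝔖.principal ↔ x ∈ 𝔖.principal := by
  rw [h𝔖]
  exact gpMap_psiPhi_mem_principalDivisors_iff 𝔉 ι induced hpre hbe hpre' hbe' hiso x

/-- **F1-Aut (`hAP`) for a support datum whose F1 field is the printed `principalDivisors`** — from `hiso` alone.
[cite: MochizukiEtTh2009, Prop 5.3 (vi) p.326 (PDF p.100)] [cite: MochizukiFrdI2008, Rem. 1.1.1 p.21] -/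
theorem hAP_of_principalDivisors (𝔖 : DivisorSupportDataQ 𝔓) (h𝔖 : 𝔖.principal = principalDivisors 𝔉.pre 𝔉.Acirc)
    (hiso : ∀ ⦃X Y : C⦄ (c : X ≅ Y), 𝔉.pre.div c.hom = 1)
    (g : Aut 𝔉.Acirc) (x : Algebra.GrothendieckGroup 𝔉.PhiAcirc) :
    ThetaFrobenioid.gpMap (𝔉.pullAut g).toMonoidHom x ∈ 𝔖.principal ↔ x ∈ 𝔖.principal := by
  rw [h𝔖]
  exact gpMap_pullAut_mem_principalDivisors_iff 𝔉 hiso g x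

/-- **[EtTh] Proposition 5.3 (i)–(vi) over PERFECT `Φ(A_⊚)` with F1 = «the image of the birational function monoid»
(`principalDivisors`), the F1 binders DISCHARGED**: `GeometryOfDivisorsPreserved (ofThm49 𝔉) 𝔓 Ψ ι e` MODULO {`induced`
([FrdI] Thm. 4.9's divisor clause), (i) as typed (Cor. 3.8 (iii)), `Ψ^{±1}` preserve pre-steps and base-equivalent pairs
([FrdI] Thm. 3.4 (ii)(v)), isomorphisms are isometries, cusp-Aut, the integral intersection-theory binder `hInt` ([EtTh] §1
p.240) and the profile of `div(Θ̈)` (`hdiv`, Prop. 1.4 (i))}.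
[cite: MochizukiEtTh2009, Prop 5.3 p.325–326 (PDF pp.99–100)] [cite: MochizukiFrdI2008, Thm. 4.9 p.88] [cite: MochizukiFrdI2008, Thm. 3.4 (v) p.63] -/
theorem geometryOfDivisorsPreserved_of_principalDivisors (𝔖 : DivisorSupportDataQ 𝔓)
    (h𝔖 : 𝔖.principal = principalDivisors 𝔉.pre 𝔉.Acirc)
    (hind : (DivisorTransportStub.ofThm49 𝔉).IsInducedBy Ψ 𝔉.Acirc e)
    (hi : PreservesCuspidality (DivisorTransportStub.ofThm49 𝔉) 𝔓 Ψ ι e)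
    (hpre : ∀ ⦃X Y : C⦄ (φ : X ⟶ Y), 𝔉.pre.IsPreStep φ → 𝔉.pre.IsPreStep (Ψ.functor.map φ))
    (hbe : ∀ ⦃X Y : C⦄ (φ ψ : X ⟶ Y), 𝔉.pre.BaseEquivalent φ ψ →
      𝔉.pre.BaseEquivalent (Ψ.functor.map φ) (Ψ.functor.map ψ))
    (hpre' : ∀ ⦃X Y : C⦄ (φ : X ⟶ Y), 𝔉.pre.IsPreStep φ → 𝔉.pre.IsPreStep (Ψ.inverse.map φ))
    (hbe' : ∀ ⦃X Y : C⦄ (φ ψ : X ⟶ Y), 𝔉.pre.BaseEquivalent φ ψ →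
      𝔉.pre.BaseEquivalent (Ψ.inverse.map φ) (Ψ.inverse.map ψ))
    (hiso : ∀ ⦃X Y : C⦄ (c : X ≅ Y), 𝔉.pre.div c.hom = 1)
    (hI : 𝔖.PrincipalIffIntegralDegreeZero)
    (θ : ℤ → ℚ) (s : ℤ) (hθ : ∀ j, θ (s - j) = θ j)
    (hdiv : ∀ (𝔫 : Primes 𝔉.PhiAcirc) (h𝔫 : ¬ 𝔓.IsCuspidal 𝔫),
      𝔖.ord 𝔫 𝔓.divTheta = θ (𝔓.ncspEquivZ ⟨𝔫, h𝔫⟩))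
    (hAc : ∀ (g : Aut 𝔉.Acirc) (𝔭 : Primes 𝔉.PhiAcirc),
      𝔓.IsCuspidal (Primes.congr (𝔉.pullAut g) 𝔭) ↔ 𝔓.IsCuspidal 𝔭) :
    GeometryOfDivisorsPreserved (DivisorTransportStub.ofThm49 𝔉) 𝔓 Ψ ι e :=
  𝔖.geometryOfDivisorsPreserved_of_principalQ Ψ ι e (DivisorTransportStub.ofThm49 𝔉) hind hi
    (𝔖.hP_of_principalDivisors Ψ ι h𝔖 hind hpre hbe hpre' hbe' hiso) hI θ s hθ hdiv hAc
    (𝔖.hAP_of_principalDivisors h𝔖 hiso)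

/-- **`hsplit` with the F1 binders replaced by their [FrdI] sources** (F1 := `principalDivisors`): abc-iut-w5-d245's
assembly binder from {`induced`, (i) on primes, [FrdI] Thm. 3.4 (ii)(v) for `Ψ^{±1}`, `hiso`, hInt, hdiv, cusp-Aut} and
the zero/pole decomposition of `div(Θ̈)`.
[cite: MochizukiEtTh2009, Thm 5.6 proof p.329 (PDF p.103)] [cite: MochizukiEtTh2009, Prop 5.3 (vi) p.326 (PDF p.100)] -/
theorem exists_pullAut_split_of_principalDivisors (𝔖 : DivisorSupportDataQ 𝔓)
    (h𝔖 : 𝔖.principal = principalDivisors 𝔉.pre 𝔉.Acirc)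
    (induced : (DivisorTransportStub.ofThm49 𝔉).IsInducedBy Ψ 𝔉.Acirc e)
    (hc : CuspPreserved 𝔓 Ψ ι e)
    (hpre : ∀ ⦃X Y : C⦄ (φ : X ⟶ Y), 𝔉.pre.IsPreStep φ → 𝔉.pre.IsPreStep (Ψ.functor.map φ))
    (hbe : ∀ ⦃X Y : C⦄ (φ ψ : X ⟶ Y), 𝔉.pre.BaseEquivalent φ ψ →
      𝔉.pre.BaseEquivalent (Ψ.functor.map φ) (Ψ.functor.map ψ))
    (hpre' : ∀ ⦃X Y : C⦄ (φ : X ⟶ Y), 𝔉.pre.IsPreStep φ → 𝔉.pre.IsPreStep (Ψ.inverse.map φ))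
    (hbe' : ∀ ⦃X Y : C⦄ (φ ψ : X ⟶ Y), 𝔉.pre.BaseEquivalent φ ψ →
      𝔉.pre.BaseEquivalent (Ψ.inverse.map φ) (Ψ.inverse.map ψ))
    (hiso : ∀ ⦃X Y : C⦄ (c : X ≅ Y), 𝔉.pre.div c.hom = 1)
    (hI : 𝔖.PrincipalIffIntegralDegreeZero)
    (θ : ℤ → ℚ) (s : ℤ) (hθ : ∀ j, θ (s - j) = θ j)
    (hdiv : ∀ (𝔫 : Primes 𝔉.PhiAcirc) (h𝔫 : ¬ 𝔓.IsCuspidal 𝔫),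
      𝔖.ord 𝔫 𝔓.divTheta = θ (𝔓.ncspEquivZ ⟨𝔫, h𝔫⟩))
    (hAc : ∀ (g : Aut 𝔉.Acirc) (𝔭 : Primes 𝔉.PhiAcirc),
      𝔓.IsCuspidal (Primes.congr (𝔉.pullAut g) 𝔭) ↔ 𝔓.IsCuspidal 𝔭)
    {Z₀ W₀ : Algebra.GrothendieckGroup 𝔉.PhiAcirc} (hZW : 𝔓.divTheta = Z₀ * W₀⁻¹)
    (hZ : ∀ 𝔫, ¬ 𝔓.IsCuspidal 𝔫 → 𝔖.ord 𝔫 Z₀ = 0) (hW : ∀ 𝔠, 𝔓.IsCuspidal 𝔠 → 𝔖.ord 𝔠 W₀ = 0) :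
    ∃ g : Aut 𝔉.Acirc,
      ThetaFrobenioid.gpMap (psiPhi 𝔉 Ψ ι e : 𝔉.PhiAcirc →* 𝔉.PhiAcirc) Z₀ =
        ThetaFrobenioid.gpMap (𝔉.pullAut g : 𝔉.PhiAcirc →* 𝔉.PhiAcirc) Z₀ ∧
      ThetaFrobenioid.gpMap (psiPhi 𝔉 Ψ ι e : 𝔉.PhiAcirc →* 𝔉.PhiAcirc) W₀ =
        ThetaFrobenioid.gpMap (𝔉.pullAut g : 𝔉.PhiAcirc →* 𝔉.PhiAcirc) W₀ :=
  𝔖.exists_pullAut_split_of_principalQ Ψ ι e hI hc (𝔖.hP_of_principalDivisors Ψ ι h𝔖 induced hpre hbe hpre' hbe' hiso)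
    θ s hθ hdiv hAc (𝔖.hAP_of_principalDivisors h𝔖 hiso) hZW hZ hW

end Principal

end DivisorSupportDataQ

end FrobenioidThetaDivisors

end Literature.AnabelianGeometry.EtaleTheta
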